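import Mathlib
import Summits.Ventures.PercRepro2.Defs
import Summits.Ventures.PercRepro2.Independence
import Summits.Ventures.PercRepro2.Harris
import Summits.Ventures.PercRepro2.Graph
import Summits.Ventures.PercRepro2.Exploration
import Summits.Ventures.PercRepro2.Events
import Summits.Ventures.PercRepro2.FourFunctions
import Summits.Ventures.PercRepro2.Induced
import Summits.Ventures.PercRepro2.Frontier
import Summits.Ventures.PercRepro2.ObsIndependence
import Summits.Ventures.PercRepro2.BHK
import Summits.Ventures.PercRepro2.BHKEvents
import Summits.Ventures.PercRepro2.SideAgreement
import Summits.Ventures.PercRepro2.VdBKahn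
import Summits.Ventures.PercRepro2.BHKAvoid
import Summits.Ventures.PercRepro2.R2PrimeThreeReduction
import Summits.Ventures.PercRepro2.YBridge
import Summits.Ventures.PercRepro2.Yu1Functionals
import Summits.Ventures.PercRepro2.Yu1Events
import Summits.Ventures.PercRepro2.Yu1
import Summits.Ventures.PercRepro2.LBSplit
import Summits.Ventures.PercRepro2.YDelta
import Summits.Ventures.PercRepro2.SD
import Summits.Ventures.PercRepro2.Threshold
import Summits.Ventures.PercRepro2.Lambda
import Summits.Ventures.PercRepro2.LambdaTau
import Summits.Ventures.PercRepro2.LambdaSlack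
import Summits.Ventures.PercRepro2.HF2
import Summits.Ventures.PercRepro2.Yu2
import Summits.Ventures.PercRepro2.N0
import Summits.Ventures.PercRepro2.Y
import Summits.Ventures.PercRepro2.YDeltaTools
import Summits.Ventures.PercRepro2.ZDelta
import Summits.Ventures.PercRepro2.ZExpand
import Summits.Ventures.PercRepro2.ISplit
import Summits.Ventures.PercRepro2.MRl
import Summits.Ventures.PercRepro2.ZOloc
import Summits.Ventures.PercRepro2.SideBridge
import Summits.Ventures.PercRepro2.HCov
import Summits.Ventures.PercRepro2.SepZero

/-!
# (A3-O) and (ONE-ROOT) from the structure of the graph: separators and leaves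
(blind cell PercRepro2, typer-1 g8; LEAD-SEP3.md §1′, §2, §3)

`SepZero.lean` proves the two exact zeros of `Gc` from pointwise event identities on
`Q = {a₁ ↮ a₂}`. Here those identities are derived from graph structure:

* **path through a separator** (`conn_sep_of_conn`): if `u` and `v` are disconnected in every
  configuration once the edges at `s` are closed (`delConfig ends {s}`) — i.e. every `u`–`v`
  path of the graph passes through `s` — then `u ↔ v` forces `u ↔ s`;
* `Gc_eq_zero_of_a3_sep'`: (A3-O) when `a₃` separates `o` from both roots;
  `Gc_eq_zero_of_root_sep'`: (ONE-ROOT) when `a₂` separates `a₁` from `{o, b, a₃}`;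
* a leaf is isolated once the edges at its neighbour are closed (`not_conn_delConfig_of_leaf`),
  hence the first and fourth rows of the LEAD-SEP3 §3 table: **`o` a leaf at `a₃`**
  (`Gc_eq_zero_of_o_leaf_at_a3`) and **`a₁` a leaf at `a₂`** (`Gc_eq_zero_of_root_leaf`) give
  `Gc = 0` exactly, for every weight of the leaf edge and every graph behind it.
-/

namespace Summit.Ventures.PercRepro2.SepZero

open CovForm

section Separator

variable {V : Type*} {E : Type*} {ends : E → Sym2 V}

/-- Closing edges only lowers the configuration. -/
lemma delConfig_le (W : Set V) (ω : Config E) : delConfig ends W ω ≤ ω := by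
  intro e
  by_cases h : e ∈ touches ends W
  · rw [delConfig_apply_of_mem h]
    exact Bool.false_le _
  · rw [delConfig_apply_of_notMem h]

/-- An edge whose endpoints differ from `s` does not touch `{s}`. -/
lemma notMem_touches_singleton {e : E} {x y s : V} (hends : ends e = s(x, y)) (hx : x ≠ s)
    (hy : y ≠ s) : e ∉ touches ends ({s} : Set V) := by
  rintro ⟨z, hz, w, hzw⟩
  rw [Set.mem_singleton_iff] at hz
  subst hz
  rw [hends, Sym2.eq_iff] at hzw
  rcases hzw with ⟨h1, _⟩ | ⟨_, h2⟩
  · exact hx h1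
  · exact hy h2

/-- **Path through a separator**: if `u ↮ v` once every edge at `s` is closed, then a connection
`u ↔ v` passes through `s`, so `u ↔ s`. -/
lemma conn_sep_of_conn {ω : Config E} {u v s : V}
    (hsep : ¬ Conn ends (delConfig ends {s} ω) u v) (huv : Conn ends ω u v) :
    Conn ends ω u s := by
  by_contra hus
  apply hsep
  refine mem_of_conn_of_closed (ends := ends) (ω := ω)
    (S := {w | Conn ends (delConfig ends {s} ω) u w}) ?_ (conn_refl _ _ _) huv
  intro x hx y hxy
  obtain ⟨_, e, he, hends⟩ := openGraph_adj.1 hxy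
  have hux : Conn ends ω u x := conn_mono (delConfig_le _ _) hx
  have hxs : x ≠ s := fun h => hus (h ▸ hux)
  have hys : y ≠ s := fun h => hus (h ▸ conn_trans hux (conn_of_openAdj ⟨e, he, hends⟩))
  have ht : e ∉ touches ends ({s} : Set V) := notMem_touches_singleton hends hxs hys
  have he' : delConfig ends {s} ω e = true := by
    rw [delConfig_apply_of_notMem ht]
    exact he
  exact conn_trans hx (conn_of_openAdj ⟨e, he', hends⟩)

/-- A leaf `u` at `s` (every edge at `u` goes to `s`) is isolated once the edges at `s` are
closed. -/
lemma not_conn_delConfig_of_leaf {ω : Config E} {u s v : V}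
    (hleaf : ∀ e, u ∈ ends e → ends e = s(u, s)) (huv : u ≠ v) :
    ¬ Conn ends (delConfig ends {s} ω) u v := by
  intro h
  have hv : v ∈ ({u} : Set V) := by
    refine mem_of_conn_of_closed (ends := ends) (ω := delConfig ends {s} ω) (S := {u}) ?_ rfl h
    intro x hx y hxy
    rw [Set.mem_singleton_iff] at hx
    subst hx
    obtain ⟨_, e, he, hends⟩ := openGraph_adj.1 hxy
    have hmem : x ∈ ends e := by
      rw [hends]
      exact Sym2.mem_mk_left _ _
    have h' := hleaf e hmem
    have ht : e ∈ touches ends ({s} : Set V) := ⟨s, rfl, x, by rw [h', Sym2.eq_swap]⟩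
    rw [delConfig_apply_of_mem ht] at he
    exact absurd he Bool.false_ne_true
  exact huv (Set.mem_singleton_iff.1 hv).symm

end Separator

section Structural

variable {V : Type*} {E : Type*} [Fintype E] [DecidableEq E] [DecidableEq V]
  {R : Type*} [Field R] [LinearOrder R] [IsStrictOrderedRing R]

omit [DecidableEq V] [LinearOrder R] [IsStrictOrderedRing R] in
/-- **(A3-O), structural form**: if `a₃` separates `o` from both roots (no connection `a_i ↔ o`
survives closing the edges at `a₃`, in any configuration), then `Gc = 0`. -/
theorem Gc_eq_zero_of_a3_sep' (p : E → R) (ends : E → Sym2 V) (o a₁ a₂ a₃ b : V)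
    (hs₁ : ∀ ω : Config E, ¬ Conn ends (delConfig ends {a₃} ω) a₁ o)
    (hs₂ : ∀ ω : Config E, ¬ Conn ends (delConfig ends {a₃} ω) a₂ o) :
    Gc p ends o a₁ a₂ a₃ b = 0 :=
  Gc_eq_zero_of_a3_sep p ends o a₁ a₂ a₃ b
    (fun ω _ => ⟨fun h => ⟨conn_sep_of_conn (fun h' => hs₁ ω (conn_symm h')) (conn_symm h),
        conn_sep_of_conn (hs₁ ω) h⟩,
      fun ⟨h1, h2⟩ => conn_trans h2 (conn_symm h1)⟩)
    (fun ω _ => ⟨fun h => ⟨conn_sep_of_conn (fun h' => hs₂ ω (conn_symm h')) (conn_symm h),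
        conn_sep_of_conn (hs₂ ω) h⟩,
      fun ⟨h1, h2⟩ => conn_trans h2 (conn_symm h1)⟩)

omit [DecidableEq V] [LinearOrder R] [IsStrictOrderedRing R] in
/-- **`o` a leaf at `a₃`** (every edge at `o` goes to `a₃`, any weight): `Gc = 0`
(LEAD-SEP3 §3, first row). -/
theorem Gc_eq_zero_of_o_leaf_at_a3 (p : E → R) (ends : E → Sym2 V) (o a₁ a₂ a₃ b : V)
    (hleaf : ∀ e, o ∈ ends e → ends e = s(o, a₃)) (h₁ : o ≠ a₁) (h₂ : o ≠ a₂) :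
    Gc p ends o a₁ a₂ a₃ b = 0 :=
  Gc_eq_zero_of_a3_sep' p ends o a₁ a₂ a₃ b
    (fun _ h => not_conn_delConfig_of_leaf hleaf h₁ (conn_symm h))
    (fun _ h => not_conn_delConfig_of_leaf hleaf h₂ (conn_symm h))

/-- **(ONE-ROOT), structural form**: if `a₂` separates `a₁` from `o`, `b` and `a₃` (no connection
from `a₁` to them survives closing the edges at `a₂`), then `Gc = 0`. -/
theorem Gc_eq_zero_of_root_sep' (p : E → R) (ends : E → Sym2 V) (o a₁ a₂ a₃ b : V)
    (hso : ∀ ω : Config E, ¬ Conn ends (delConfig ends {a₂} ω) a₁ o)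
    (hsb : ∀ ω : Config E, ¬ Conn ends (delConfig ends {a₂} ω) a₁ b)
    (hs₃ : ∀ ω : Config E, ¬ Conn ends (delConfig ends {a₂} ω) a₁ a₃) :
    Gc p ends o a₁ a₂ a₃ b = 0 :=
  Gc_eq_zero_of_root_sep p ends o a₁ a₂ a₃ b fun ω h12 =>
    ⟨fun h => h12 (conn_sep_of_conn (hso ω) h), fun h => h12 (conn_sep_of_conn (hsb ω) h),
      fun h => h12 (conn_sep_of_conn (hs₃ ω) h)⟩

/-- **`a₁` a leaf at `a₂`** (every edge at `a₁` goes to `a₂`, any weight): `Gc = 0`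
(LEAD-SEP3 §3, fourth row). -/
theorem Gc_eq_zero_of_root_leaf (p : E → R) (ends : E → Sym2 V) (o a₁ a₂ a₃ b : V)
    (hleaf : ∀ e, a₁ ∈ ends e → ends e = s(a₁, a₂)) (ho : a₁ ≠ o) (hb : a₁ ≠ b) (h₃ : a₁ ≠ a₃) :
    Gc p ends o a₁ a₂ a₃ b = 0 :=
  Gc_eq_zero_of_root_sep' p ends o a₁ a₂ a₃ b (fun _ => not_conn_delConfig_of_leaf hleaf ho)
    (fun _ => not_conn_delConfig_of_leaf hleaf hb) (fun _ => not_conn_delConfig_of_leaf hleaf h₃)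

end Structural

end Summit.Ventures.PercRepro2.SepZero
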